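import Literature.AlgebraicGeometry.Resolution.ArithmeticalThreefoldsLocalFrameDim
import Literature.AlgebraicGeometry.Resolution.QuadraticTransformsRegular
import Literature.AlgebraicGeometry.Resolution.AdicCompletionRegular
import Literature.AlgebraicGeometry.Resolution.CohenMacaulayCatenary
import Summits.ResolutionOfSingularities.ResolutionOfSingularities.Theorems.FrobeniusClosingSteerCore4IsoChartZero
import Mathlib.RingTheory.Algebraic.Basic
import HarnessLib

/-!
# T2 support: the centre of `O` on a quadratic transform is again `d`-generated (chain W4.1, crux `Steer`)

Topic: `Summits/ResolutionOfSingularities/ResolutionOfSingularities/Theorems`. Helper for seam **T2**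
(`chart_step`, res-L0-w41-stub-1) of the dictionary behind the registered stub `stub_core4Dictionary` on
`Theses.FrobeniusClosing.Steer` (stmt-ResolutionOfSingularities-16345): the LAST conjunct of `chart_step` /
of the landed leaf's `hT2` (`FrobeniusClosingSteerCore4DictionaryLeaf`, p480959),

  `(Ideal.comap (Subring.inclusion hR₁) (maximalIdeal O)).spanFinrank = d`,

from the binders `chart_step` already carries (`k₀ ⊆ κ` with `κ/k₀` algebraic, every element of `k₀` a residue
of `R`, `ι : ResidueField O →+* κ`, `R` regular of embedding dimension `d` dominated by `O`,
`hQ : IsQuadraticTransformAlong O R R₁`). Route («halg-packaging», offered out in stub-1's T2 plan):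

* `exists_poly_unit_coeff_valuation_lt` — those binders give the RESIDUAL ALGEBRAICITY hypothesis `halg` of the
  tree's dimension theorem: every `y ∈ O` is a root modulo `𝔪_O` of a polynomial over `R` with a unit coefficient
  (lift the coefficients of a `k₀`-relation of `ι(res y)` through `hk₀`);
* `spanFinrank_centre_eq_of_isQuadraticTransformAlong` — `R₁` is regular (tree
  `IsQuadraticTransformAlong.isRegularLocalRing_of_isRegularLocalRing`), `dim R₁ = dim R` (tree
  `ringKrullDim_eq_of_isQuadraticTransformAlong`, `R` universally catenary as a regular ring), the centre of `O`
  on `R₁` is `𝔪_{R₁}` (domination, `ChartZero.comap_maximalIdeal_eq_of_subringDominates`), so its minimal number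
  of generators is `dim R₁ = dim R = d`.

OURS (campaign res-hironaka, rung L, slot W4.1); no `Theses.*` / `Cruxes.*` import; NOT a statement of the
manuscript under review [claim: Hironaka2017, status: under-review].
-/

set_option linter.dupNamespace false

noncomputable section

open IsLocalRing Literature.AlgebraicGeometry.Resolution Polynomial

namespace Summit.ResolutionOfSingularities.ResolutionOfSingularities.Theorems.SwitchingDichotomy.ChartStepDim

variable {K : Type} [Field K]

/-- **Residual algebraicity from the chart-step binders.** If `κ ⊇ k₀` is algebraic over the subfield `k₀`,
every element of `k₀` is (the image under `ι : ResidueField O →+* κ` of) the residue of an element of the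
local subring `R ⊆ O` dominated by `O`, then every `y ∈ O` is a root modulo `𝔪_O` of a polynomial over `R`
having a coefficient outside `𝔪_R` (= the hypothesis `halg` of the tree's
`ringKrullDim_eq_of_isQuadraticTransformAlong`). [folklore] -/
theorem exists_poly_unit_coeff_valuation_lt (O : ValuationSubring K) {κ : Type} [Field κ]
    (ι : ResidueField O →+* κ) (k₀ : Subfield κ) (halg : Algebra.IsAlgebraic k₀ κ)
    (R : Subring K) (hR : R ≤ O.toSubring) [IsLocalRing R] (hdom : SubringDominates R O.toSubring)
    (hk₀ : ∀ a ∈ k₀, ∃ r : R, ι (residue O (Subring.inclusion hR r)) = a) (y : O) :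
    ∃ q : R[X], (∃ i, q.coeff i ∉ maximalIdeal R) ∧ O.valuation (aeval (y : K) q) < 1 := by
  classical
  -- an algebraic relation of `b := ι (res y)` over `k₀`
  set b : κ := ι (residue O y) with hb
  obtain ⟨Q, hQ0, hQb⟩ := (halg.isAlgebraic b)
  -- lift its coefficients to `R`
  choose r hr using fun i : ℕ => hk₀ ((Q.coeff i : k₀) : κ) (Q.coeff i).2
  let q : R[X] := ∑ i ∈ Q.support, monomial i (r i)
  have hqcoeff : ∀ i, q.coeff i = if i ∈ Q.support then r i else 0 := by
    intro i
    simp only [q, finsetSum_coeff, coeff_monomial, Finset.sum_ite_eq']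
  refine ⟨q, ?_, ?_⟩
  · -- a non-zero coefficient of `Q` lifts to a unit of `R`
    obtain ⟨i, hi'⟩ := Finset.nonempty_iff_ne_empty.mpr (mt Polynomial.support_eq_empty.mp hQ0)
    have hi : Q.coeff i ≠ 0 := mem_support_iff.mp hi'
    refine ⟨i, fun hmem => hi ?_⟩
    have hmem' : q.coeff i = r i := by rw [hqcoeff, if_pos hi']
    -- `q.coeff i ∈ 𝔪_R ⇒ res = 0 ⇒ Q.coeff i = 0`
    have hv : O.valuation ((q.coeff i : R) : K) < 1 :=
      ((subringDominates_valuationSubring_iff hR).mp hdom _).mp hmem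
    have hres : residue O (Subring.inclusion hR (q.coeff i)) = 0 := by
      rw [residue_eq_zero_iff, ValuationSubring.valuation_lt_one_iff]
      exact hv
    have := hr i
    rw [← hmem', hres, map_zero] at this
    exact_mod_cast this.symm
  · -- `q(y) ≡ Q(b) = 0` modulo `𝔪_O`, read through the injective `ι`
    let incl : R →+* O := Subring.inclusion hR
    let w : O := q.eval₂ incl y
    have hval : (w : K) = aeval (y : K) q := by
      have hmap : algebraMap R K = O.subtype.comp incl := RingHom.ext fun _ => rfl
      rw [aeval_def, hmap]
      exact Polynomial.hom_eval₂ q incl O.subtype y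
    have hcoef : q.map ((ι.comp (residue O)).comp incl) = Q.map (algebraMap k₀ κ) := by
      ext i
      rw [coeff_map, coeff_map, hqcoeff]
      split_ifs with hi
      · exact hr i
      · rw [map_zero, notMem_support_iff.mp hi, map_zero]
    have hres : residue O w = 0 := by
      apply ι.injective
      have h1 : ι (residue O w) = q.eval₂ ((ι.comp (residue O)).comp incl) (ι (residue O y)) :=
        Polynomial.hom_eval₂ q incl (ι.comp (residue O)) y
      rw [map_zero, h1, ← Polynomial.eval_map, hcoef, Polynomial.eval_map, ← aeval_def, ← hb, hQb]
    rw [← hval, ← ValuationSubring.valuation_lt_one_iff]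
    exact (residue_eq_zero_iff w).mp hres

/-- **The centre of `O` on a quadratic transform of a `d`-dimensional regular base is `d`-generated** — the
last conjunct of `chart_step` / `hT2`: for `R ⊆ O` regular local of embedding dimension `d`, dominated by `O`,
with `κ(O)` algebraic over the residues of `R` (packaged as in `exists_poly_unit_coeff_valuation_lt`), and
`R ⊂ R₁` a quadratic transform along `O`, the centre `𝔪_O ∩ R₁` of `O` on `R₁` is minimally generated by `d`
elements: `R₁` is regular local (`isRegularLocalRing_of_isRegularLocalRing`), dominated by `O`, and
`dim R₁ = dim R` (`ringKrullDim_eq_of_isQuadraticTransformAlong`, regular rings being universally catenary).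
[cite: CossartPiltant2019, Prop. 2.7] [folklore] -/
theorem spanFinrank_centre_eq_of_isQuadraticTransformAlong (O : ValuationSubring K) {κ : Type} [Field κ]
    (ι : ResidueField O →+* κ) (k₀ : Subfield κ) (halg : Algebra.IsAlgebraic k₀ κ)
    (R R₁ : Subring K) (hR : R ≤ O.toSubring) (hR₁ : R₁ ≤ O.toSubring)
    [IsRegularLocalRing R] (hdom : SubringDominates R O.toSubring) (hQ : IsQuadraticTransformAlong O R R₁)
    (hk₀ : ∀ a ∈ k₀, ∃ r : R, ι (residue O (Subring.inclusion hR r)) = a)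
    (d : ℕ) (hd : (maximalIdeal R).spanFinrank = d) :
    (Ideal.comap (Subring.inclusion hR₁) (maximalIdeal O)).spanFinrank = d := by
  haveI hR₁reg : IsRegularLocalRing R₁ := hQ.isRegularLocalRing_of_isRegularLocalRing inferInstance
  haveI : IsRegularRing R := isRegularRing_of_isRegularLocalRing R
  have hdim : ringKrullDim R₁ = ringKrullDim R :=
    ringKrullDim_eq_of_isQuadraticTransformAlong O (isUniversallyCatenaryRing_of_isRegularRing' R)
      (fun r hr => ((subringDominates_valuationSubring_iff hR).mp hdom r).mp hr)
      (exists_poly_unit_coeff_valuation_lt O ι k₀ halg R hR hdom hk₀) hQ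
  rw [ChartZero.comap_maximalIdeal_eq_of_subringDominates O R₁ hR₁ hQ.dominated]
  have h1 := IsRegularLocalRing.spanFinrank_maximalIdeal (R := R₁)
  have h2 := IsRegularLocalRing.spanFinrank_maximalIdeal (R := R)
  rw [hdim, ← h2, hd] at h1
  exact_mod_cast h1

end Summit.ResolutionOfSingularities.ResolutionOfSingularities.Theorems.SwitchingDichotomy.ChartStepDim

end
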